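import Summits.QuantumFields.YangMills.Theorems.Instrument.BesselCapObjectsKZL2rpLIM
import Summits.QuantumFields.GaugeBoot.Rows.KZL2rpD4Red
import Summits.QuantumFields.GaugeBoot.Rows.KZL2rpD4BindB11o5W12
import Literature.Analysis.Matrix.NonnegTaylorHadamard
import HarnessLib

/-!
# YM instrument cell — `SU(2)`, `D = 4`: the Class-A feasibility of the kz-L2-rp-4D files holds for the class-LIMIT variables
# `yLim μ`, and a Class-A certificate REPLAYS at limit points (template of a class-LIMIT bind)

Cell `ym-instrument` (HUMAN RULING D-0084 (2); director-ym R138; HOME `run/shared/lean/pub/ym-instrument/`), crew (a),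
Lean typist seat `ym-instrument-boot-lean-1` (gen 3). Question Q-A1; ladder consequence: provenance of the class-LIMIT rows of
TABLE-A1 (IR `stmt-QuantumFields-19354`, THE NUMBER) — this file is GROUNDWORK for a kernel replay of class-LIMIT certificates
(«certificate→limit-point bind», typed NO for every LIMIT row of record): it shows that the three Class-A hypothesis families
of the kz-L2-rp-4D certificate halves (`Certificates/KZL2rpD4b*…var_le/ge_of_feasible_agg`, `objective_ge_of_feasible`; they
are stated for an ARBITRARY vector `y : Fin 10878 → ℝ`) hold for `y := yLim μ` at every infinite-volume limit point `μ` along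
even tori: (i) `yLim μ 0 = 1` and the boxes (file `BesselCapObjectsKZL2rpLIM`); (ii) EVERY finite linear identity
`Σ_v a_v y_v = r` valid on all even tori `L ≥ L₀` (in particular the lean2-lane aggregated loop-equation rows `hagg_*`) passes to
`yLim` (`sum_mul_yLim_eq_of_forall`); (iii) the 70 REDUCED positivity blocks `redBlock k (yLim μ)` are positive semidefinite
(`redBlock_posSemidef_yLim`; entrywise limits of PSD matrices, `Literature…posSemidef_of_tendsto`). DEMO (0 kit, no new
certificate): the Class-A END of record `SU2-D4-b11o5-kzL2rp-w1x2-upper` (kernel-typed on tori as `KZL2rpD4.w12_b11o5_upper`,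
p471177) REPLAYED against the limit variables: `yLim μ 2 = ∫ W̄(2×1) dμ ≤ 770119544090785676389214070494717/1493427621795000672392419737600000`
(≤ 0.5156724925) at every limit point along even tori at `β_std = 11/5` (`yLim_two_le_b11o5`) — the same number the torus
window gives by passing to the limit (`WilsonLoopWindow.integral_limit_mem`); what is new is the ROUTE (certificate half applied
to `yLim`), which is the one a class-LIMIT END needs, its extra hypotheses being exactly the typed LIMIT objects of
`BesselCapLimitHankel` / `BesselCapObjectsKZL2rpLIM` / `LimitObjectsKZL2rpLIM` (hk/hd/hdcap blocks and rows in `yLim` terms).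
NOT here: a class-LIMIT certificate half (the inherited lean3 emitter has no ineq-row / LIMIT-block / ρ_v-box mode yet).

HONEST FRAMING (page 1 of every file of this cell): WHAT IS CERTIFIED HERE, AT WHICH `(G, D, L, β)`: `G = SU(2)` (fundamental,
standard Wilson action, tree coupling `β/2`), `D = 4`, class LIMIT = infinite-volume limit points of the torus Wilson states along
strictly increasing sequences of EVEN tori, `β_std ≥ 0` ((ii)–(iii)), `β_std = 11/5` (demo). A bound on ONE lattice expectation
at ONE coupling at limit points; NOT a finite-torus statement beyond what it quotes, not an area law, string tension, mass gap or
continuum statement; no uniqueness of the limit; nothing summit-bearing.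
-/

noncomputable section

namespace Summit.QuantumFields.YangMills.Theorems.Instrument

open MeasureTheory Filter Topology Finset
open Summit.QuantumFields.GaugeBoot
open Summit.QuantumFields.GaugeBoot.Certificates
open Summit.QuantumFields.GaugeBoot.Certificates.Sparse
open Literature.MathematicalPhysics.QuantumFieldTheory
open Literature.MathematicalPhysics.QuantumLattice (LGConfig IsInfiniteVolumeLimitAlong)
open Literature.Analysis.Matrix.NonnegTaylorHadamard (posSemidef_of_tendsto)

/-! ## Sparse combinations and reduced blocks are continuous in the variables -/

/-- `evalComb L` is (sequentially) continuous: pointwise convergence of the variables gives convergence of every sparse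
combination. [folklore] -/
theorem tendsto_evalComb {nv : ℕ} {yk : ℕ → Fin nv → ℝ} {y : Fin nv → ℝ}
    (h : ∀ v, Tendsto (fun k => yk k v) atTop (𝓝 (y v))) :
    ∀ L : List (ℕ × ℤ), Tendsto (fun k => evalComb L (yk k)) atTop (𝓝 (evalComb L y))
  | [] => by simp only [evalComb_nil]; exact tendsto_const_nhds
  | (w, c) :: rest => by
    simp only [evalComb_cons]
    refine Tendsto.add ?_ (tendsto_evalComb h rest)
    by_cases hw : w < nv
    · simp only [hw, dite_true]
      exact (h ⟨w, hw⟩).const_mul _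
    · simp only [hw, dite_false]
      exact tendsto_const_nhds

/-- **Reduced blocks pass to the limit**: if `yk k → y` pointwise and the 70 reduced kz-L2-rp-4D blocks are PSD at `yk k` for all
large `k`, they are PSD at `y`. [folklore] -/
theorem redBlock_posSemidef_of_tendsto {yk : ℕ → Fin 10878 → ℝ} {y : Fin 10878 → ℝ}
    (h : ∀ v, Tendsto (fun k => yk k v) atTop (𝓝 (y v)))
    (hpsd : ∀ᶠ k in atTop, ∀ j : Fin 70, (Certificates.KZL2rpD4.redBlock j (yk k)).PosSemidef) (j : Fin 70) :
    (Certificates.KZL2rpD4.redBlock j y).PosSemidef :=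
  posSemidef_of_tendsto (hpsd.mono fun k hk => hk j) fun i i' => by
    simp only [Certificates.KZL2rpD4.redBlock_apply]
    exact tendsto_evalComb h _

/-! ## Class-A feasibility of the class-LIMIT variables `yLim μ` -/

variable {β : ℝ} {Lk : ℕ → ℕ} {μ : Measure (LGConfig 4 (SU 2))}

/-- **(iii) THE 70 REDUCED POSITIVITY BLOCKS ARE PSD AT EVERY LIMIT POINT** along even tori (`β_std ≥ 0`): limit of the tree's
torus theorem `KZL2rpD4.redBlock_posSemidef` (even `L ≥ 6`). [folklore] -/
theorem redBlock_posSemidef_yLim (hβ : 0 ≤ β) (hmono : StrictMono Lk) (heven : ∀ k, Even (Lk k + 1))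
    (hμ : IsInfiniteVolumeLimitAlong (suRep 2) (β / (2 : ℕ)) Lk μ) (j : Fin 70) :
    (Certificates.KZL2rpD4.redBlock j (yLim μ)).PosSemidef :=
  redBlock_posSemidef_of_tendsto (yk := fun k => KZL2rpD4.y β (Lk k + 1)) (tendsto_y_yLim hμ)
    (Filter.eventually_atTop.2 ⟨5, fun k hk => by
      have hk' : k ≤ Lk k := hmono.id_le k
      exact KZL2rpD4.redBlock_posSemidef β (Lk k + 1) hβ (heven k) (by omega)⟩) j

/-- **(ii) FINITE LINEAR IDENTITIES PASS TO THE LIMIT**: if `Σ_v a_v · y β L v = r` on every even torus `L ≥ L₀`, then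
`Σ_v a_v · yLim μ v = r` at every limit point along even tori. [folklore] -/
theorem sum_mul_yLim_eq_of_forall (hmono : StrictMono Lk) (heven : ∀ k, Even (Lk k + 1))
    (hμ : IsInfiniteVolumeLimitAlong (suRep 2) (β / (2 : ℕ)) Lk μ) {a : Fin 10878 → ℝ} {r : ℝ} {L₀ : ℕ}
    (h : ∀ L : ℕ, [NeZero L] → L₀ ≤ L → Even L → ∑ v, a v * KZL2rpD4.y β L v = r) :
    ∑ v, a v * yLim μ v = r := by
  have hlim : Tendsto (fun k => ∑ v, a v * KZL2rpD4.y β (Lk k + 1) v) atTop (𝓝 (∑ v, a v * yLim μ v)) :=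
    tendsto_finsetSum _ fun v _ => (tendsto_y_yLim hμ v).const_mul (a v)
  have hev : ∀ᶠ k in atTop, ∑ v, a v * KZL2rpD4.y β (Lk k + 1) v = r :=
    Filter.eventually_atTop.2 ⟨L₀, fun k hk => by
      have hk' : k ≤ Lk k := hmono.id_le k
      exact h (Lk k + 1) (by omega) (heven k)⟩
  exact tendsto_nhds_unique hlim (tendsto_const_nhds.congr' (hev.mono fun k hk => hk.symm))

/-! ## DEMO: the Class-A END `SU2-D4-b11o5-kzL2rp-w1x2-upper` replayed against the limit variables -/

/-- The lean2-lane aggregated equality row of the upper `W̄(1×2)` certificate at `β_std = 11/5` holds for `yLim μ`. [folklore] -/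
theorem hagg_11o5W12U_yLim (hmono : StrictMono Lk) (heven : ∀ k, Even (Lk k + 1))
    (hμ : IsInfiniteVolumeLimitAlong (suRep 2) ((11 / 5 : ℝ) / (2 : ℕ)) Lk μ) :
    ∑ v, (KZL2rpD4b11o5W12UpRow.aggRow v : ℝ) * yLim μ v = KZL2rpD4b11o5W12UpRow.aggRhs :=
  sum_mul_yLim_eq_of_forall hmono heven hμ (L₀ := 6) fun L _ hL0 _ => KZL2rpD4.hagg_11o5W12U L hL0

/-- **`∫ W̄(2×1) dμ = yLim μ 2 ≤ 770119544090785676389214070494717 / 1493427621795000672392419737600000` (≤ 0.5156724925) at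
every infinite-volume limit point along even tori at `β_std = 11/5`** — the Class-A certificate half
`KZL2rpD4b11o5W12Up.var_le_of_feasible_agg` applied to `y := yLim μ` (unit column, boxes, aggregated row, 70 reduced blocks
all discharged at the limit). [folklore] -/
theorem yLim_two_le_b11o5 (hmono : StrictMono Lk) (heven : ∀ k, Even (Lk k + 1))
    (hμ : IsInfiniteVolumeLimitAlong (suRep 2) ((11 / 5 : ℝ) / (2 : ℕ)) Lk μ) :
    yLim μ 2 ≤ 770119544090785676389214070494717 / 1493427621795000672392419737600000 := by
  have h := KZL2rpD4b11o5W12Up.var_le_of_feasible_agg (y := yLim μ) (yLim_zero hμ) (fun v _ => abs_yLim_le_one hμ v)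
    (hagg_11o5W12U_yLim hmono heven hμ) (redBlock_posSemidef_yLim (by norm_num) hmono heven hμ)
  refine h.trans (le_of_eq ?_)
  norm_num [KZL2rpD4b11o5W12Up.lowerQ]

/-- The same bound for the rectangle expectation `g₁(2) = ∫ W̄(2 × 1) dμ` of `WilsonLoopLimitMonotone` (dictionary
`yLim_two`). [folklore] -/
theorem gLim_two_one_le_b11o5 (hmono : StrictMono Lk) (heven : ∀ k, Even (Lk k + 1))
    (hμ : IsInfiniteVolumeLimitAlong (suRep 2) ((11 / 5 : ℝ) / (2 : ℕ)) Lk μ) :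
    gLim μ 1 1 2 ≤ 770119544090785676389214070494717 / 1493427621795000672392419737600000 := by
  rw [← yLim_two hμ]
  exact yLim_two_le_b11o5 hmono heven hμ

end Summit.QuantumFields.YangMills.Theorems.Instrument

end
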